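import Literature.Analysis.FluidPDE.Tao2016AveragedNS.CircuitShadowing
import HarnessLib

/-!
# Tao 2016, §5.5 — gate fragility: the delay circuit's robustness radius is NECESSARILY tiny

T. Tao, *Finite time blowup for an averaged three-dimensional Navier–Stokes equation*, J. Amer.
Math. Soc. **29** (2016) 601–674 = arXiv:1402.0290, §5.1 (the pump gate and its explicit solution
(pomp)), §5.5 (the five-mode delay circuit (5.5) with datum (5.6), Theorem 5.3: the "delayed abrupt
energy transition" `a → ã` at time `t_c ≈ √2`). [`Tao2016AveragedNS`]
E. Hairer, S. P. Nørsett, G. Wanner, *Solving Ordinary Differential Equations I*, 2nd ed. (Springer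
1993), §I.10 (defects, approximate solutions, the fundamental lemma). [`HairerNorsettWanner1993`]

HONEST FRAMING (cell pub-fluidc, verbatim): *low prior, high value-of-information experiment on
Tao's machine paradigm; NOT a claim that NS blows up.* Everything in this file is finite-dimensional
ODE theory about Tao's TOY circuit (5.5); nothing is asserted about the Navier–Stokes equations.

## Why this file exists (cell pub-fluidc, recommendation R2 / DICTIONARY.md §8–§9)

`CircuitShadowing.lean` gives a kernel-checked SUFFICIENT robustness radius of the gate (5.5): every
pseudo-orbit (approximate solution with defect `δ`, issued `δ₀`-close to the datum (5.6)) whose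
forcing budget obeys `δ₀ + δT ≤ shadowRadius K ε R T θ = θ·exp(-delayLipschitz K ε R · T)` still
performs the delayed abrupt transition of Theorem 5.3 up to an efficiency loss `θ` (packaged here as
the predicate `FiresOnBudget K ε R T C θ r`, `firesOnBudget_shadowRadius`). That radius is
exponentially small in the rotor speed `ε⁻²`, and the file says honestly that it is a worst case.

This file supplies the complementary NECESSARY smallness, by two explicit adversaries aimed at the
circuit's CLOCK — the tiny seed coupling `ε²e^{-K¹⁰}` of the pump `a → c`, which is what makes the
transition *delayed* (Tao, §5.5: "the tiny amount of energy … being steadily pumped into the `c`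
mode"; the transfer happens once `exp(K¹⁰t²/2 - K¹⁰)` becomes of order one, i.e. near `t = √2`):

* SEED CHANNEL (defect sense; `seedFreeOrbit`, `seedFreeOrbit_isPseudoOrbit`,
  `not_firesOnBudget_of_seed_mul_le`). The free pump orbit `(a,b) = (sech εt, tanh εt)` (§5.1
  (pomp)) padded with `c = d = ã = 0` starts EXACTLY at (5.6) and solves (5.5) up to the defect
  `-ε²e^{-K¹⁰}a² · e_c` of sup-size `≤ ε²e^{-K¹⁰}` — an adversarial forcing that merely cancels the
  seed. Its output mode is identically `0`: the gate never fires. Hence NO robustness statement of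
  the `FiresOnBudget` form can hold with a budget `r ≥ ε²e^{-K¹⁰}·T`: in the defect sense the
  robustness radius of the gate is at most the seed rate itself (super-exponentially small in `K`).
* PUMP-BIAS CHANNEL (kick sense, EXACT dynamics; `biasInit`, `bias_abs_c_le`, `bias_out_le`,
  `not_hasAbruptTransition_of_bias`, `not_firesOnBudget_of_two_mul_eps_le`). Start (5.5) from the
  energy-one datum `(√(1-β²), -β, 0, 0, 0)`, at sup-distance `β` from (5.6). Since
  `∂ₜb = εa² - ε⁻¹K¹⁰c² ≤ ε`, the mode `b` stays `≤ 0` on `[0, β/ε]`, so the amplifier `b → c` is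
  switched OFF there and `c` only collects the seed: `|c(t)| ≤ ε²e^{-K¹⁰}t`, whence (rotor)
  `√(d²+ã²) ≤ e^{-K¹⁰}t²/2`. For `β ≥ 2ε` this covers `t = 2 ≥ t_c + K^{-1/2}`, where Theorem 5.3
  demands `ã ≥ 1 - CK⁻¹⁰`: the kicked exact trajectory does NOT have the abrupt transition with the
  designed timing (it fires late, after `≈ β/ε` instead of `√2`). Hence the kick-robustness radius
  of Theorem 5.3's conclusion is `< 2ε`, and `FiresOnBudget` fails for every budget `r ≥ 2ε`.
* SANDWICH (`shadowRadius_lt_seed_mul`, `shadowRadius_lt_two_mul_eps`, and the unconditional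
  package `gate_fragility`): granted Theorem 5.3 for `delaySolution K ε` (proved in the tree:
  `delaySolution_hasAbruptTransition`), the gate fires on the budget `shadowRadius` of
  `CircuitShadowing.lean` and on no budget `≥ ε²e^{-K¹⁰}T` or `≥ 2ε`; in particular
  `shadowRadius K ε R T θ < min (ε²e^{-K¹⁰}T) (2ε)` in the stated parameter range.

## What this says for the dictionary (DICTIONARY.md §9) — and what it does NOT say

* CLOCK FRAGILITY is intrinsic to the design, not an artefact of Grönwall: the delay `t_c ≈ √2` is
  read off a clock driven by a signal of size `ε²e^{-K¹⁰}`; any un-designed input into `c` of that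
  size (defect sense), or any bias of the pump variable `b` of size `ε` (kick sense), re-times or
  stalls the gate. Robustness radius (defect) `≤` seed rate; (kick, timing-faithful) `< 2ε`.
* TENSION: the features that make the gate a good DELAY (tiny seed ⇒ long quiescent window ⇒ clean
  separation of generations, cf. the hierarchy `1 ≪ 1/ε₀ ≪ K ≪ 1/ε ≪ n₀` of §6.1) are exactly the
  features that make it FRAGILE. Tao pays nothing for this: in Prop. 6.5 the only perturbations are
  the designed cross-level / dissipative errors of relative size `(1+ε₀)^{-n₀/2}` with `n₀` chosen
  LAST, which beats `ε²e^{-K¹⁰}`. A gadget for TRUE Navier–Stokes has no such last parameter: its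
  defect relative to the designed circuit (pressure, undesigned triads; DIVERGENCE.md F2/F3) must be
  driven below the seed rate of its own clock, generation-uniformly — or the clock must be redesigned.
* NOT claimed: that a kicked or forced trajectory never transfers its energy (it typically fires
  LATE — the pump-bias witness is a statement about timing on `[0,2]`, which is what Theorem 5.3 and
  the cascade bookkeeping of §6.4 consume); nothing about structured (energy-non-injecting) forcing,
  which is `Stability.lean`'s business; nothing about Navier–Stokes.

## Design choices
* Same conventions as `CircuitShadowing.lean`: sup norm on `Fin 5 → ℝ`, `R : ℝ≥0`, pseudo-orbits
  `IsPseudoOrbit`, the conclusion of `IsPseudoOrbit.fires_of_budget` verbatim inside `FiresOnBudget`.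
* The kicked trajectory is ANY global solution from `biasInit β` (one exists:
  `exists_solution_biasInit`, by `IsCancelling.exists_solution`); only one-sided comparison
  (`Thm53.antitoneOn_sub_of_deriv_le`) and energy conservation are used — no uniqueness, no
  numerics. Constants explicit and unoptimised (`2ε`, `t = 2`).
* No named facts, no axioms; three definitions (`seedFreeOrbit`, `biasInit`, `FiresOnBudget`).

## References
* T. Tao, JAMS 29 (2016) 601–674, arXiv:1402.0290: §5.1 (pomp); §5.5 (5.5)/(5.6), Theorem 5.3 and
  its proof (roles of the seed `ε²e^{-K¹⁰}` and of the sign of `b`); §6.1; §6.4. [`Tao2016AveragedNS`]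
* E. Hairer, S. P. Nørsett, G. Wanner, Solving ODE I (1993), §I.10. [`HairerNorsettWanner1993`]
-/

noncomputable section

open Set Metric Real
open scoped NNReal

namespace Literature.Analysis.FluidPDE.Tao2016AveragedNS

/-! ## A. The seed channel: the free pump orbit is a seed-sized pseudo-orbit that never fires -/

/-- The **seed-free orbit**: the explicit free pump trajectory `(a,b) = (sech εt, tanh εt)` of §5.1
(pomp) (coupling `ε`, amplitude `1`), padded with `c = d = ã = 0`. It is what (5.5) does from (5.6)
when the seed pump `a → c` is exactly cancelled. [cite: Tao2016AveragedNS, §5.1 (pomp), §5.5 (5.5)] -/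
def seedFreeOrbit (ε : ℝ) (t : ℝ) : Fin 5 → ℝ :=
  ![pumpSolution ε 1 t 0, pumpSolution ε 1 t 1, 0, 0, 0]

/-- The seed-free orbit starts at the datum (5.6). [cite: Tao2016AveragedNS, §5.5 (5.6)] -/
theorem seedFreeOrbit_zero (ε : ℝ) : seedFreeOrbit ε 0 = delayInit := by
  ext i
  fin_cases i <;> simp [seedFreeOrbit, pumpSolution, delayInit]

/-- Its `c`-mode vanishes identically. [cite: Tao2016AveragedNS, §5.5 (5.5)] -/
@[simp] theorem seedFreeOrbit_c (ε t : ℝ) : seedFreeOrbit ε t 2 = 0 := by simp [seedFreeOrbit]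

/-- Its `d`-mode vanishes identically. [cite: Tao2016AveragedNS, §5.5 (5.5)] -/
@[simp] theorem seedFreeOrbit_d (ε t : ℝ) : seedFreeOrbit ε t 3 = 0 := by simp [seedFreeOrbit]

/-- Its OUTPUT mode `ã` vanishes identically: the seed-free orbit never fires.
[cite: Tao2016AveragedNS, §5.5 (5.5)] -/
@[simp] theorem seedFreeOrbit_output (ε t : ℝ) : seedFreeOrbit ε t 4 = 0 := by
  simp [seedFreeOrbit]

/-- Energy of the pump pair along the seed-free orbit: `a² + b² = 1` (energy conservation of the
pump gate, §5.1). [cite: Tao2016AveragedNS, §5.1 (pomp)] -/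
theorem seedFreeOrbit_sq_add_sq (ε t : ℝ) :
    seedFreeOrbit ε t 0 ^ 2 + seedFreeOrbit ε t 1 ^ 2 = 1 := by
  have h := energy_eq_of_isCancelling (isCancelling_pumpGate ε) (hasDerivAt_pumpSolution ε 1) t 0
  rw [pumpSolution_zero] at h
  simp only [energy, Fin.sum_univ_two, Fin.isValue, Matrix.cons_val_zero, Matrix.cons_val_one,
    one_pow, ne_eq, OfNat.ofNat_ne_zero, not_false_eq_true, zero_pow, add_zero] at h
  simpa [seedFreeOrbit] using h

/-- Every mode of the seed-free orbit is bounded by `1`. [cite: Tao2016AveragedNS, §5.1 (pomp)] -/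
theorem seedFreeOrbit_abs_le_one (ε t : ℝ) (i : Fin 5) : |seedFreeOrbit ε t i| ≤ 1 := by
  have h2 := seedFreeOrbit_sq_add_sq ε t
  have h0 : seedFreeOrbit ε t 0 ^ 2 ≤ 1 := by nlinarith [sq_nonneg (seedFreeOrbit ε t 1)]
  have h1 : seedFreeOrbit ε t 1 ^ 2 ≤ 1 := by nlinarith [sq_nonneg (seedFreeOrbit ε t 0)]
  fin_cases i
  · exact (sq_le_one_iff_abs_le_one _).1 h0
  · exact (sq_le_one_iff_abs_le_one _).1 h1
  · simp
  · simp
  · simp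

/-- The seed-free orbit stays in the unit sup-ball. [cite: Tao2016AveragedNS, §5.1 (pomp)] -/
theorem seedFreeOrbit_norm_le (ε t : ℝ) : ‖seedFreeOrbit ε t‖ ≤ 1 :=
  (pi_norm_le_iff_of_nonneg zero_le_one).2 fun i => by
    rw [Real.norm_eq_abs]; exact seedFreeOrbit_abs_le_one ε t i

/-- The seed-free orbit is differentiable, with velocity the free pump field padded by zeros.
[cite: Tao2016AveragedNS, §5.1 (pump), (pomp)] -/
theorem hasDerivAt_seedFreeOrbit (ε t : ℝ) :
    HasDerivAt (seedFreeOrbit ε)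
      ![-(ε * seedFreeOrbit ε t 0 * seedFreeOrbit ε t 1), ε * seedFreeOrbit ε t 0 ^ 2, 0, 0, 0]
      t := by
  have hp := hasDerivAt_pumpSolution ε 1 t
  have h0 : HasDerivAt (fun s => pumpSolution ε 1 s 0)
      (-(ε * pumpSolution ε 1 t 0 * pumpSolution ε 1 t 1)) t := by
    simpa [pumpGate] using hasDerivAt_pi.1 hp 0
  have h1 : HasDerivAt (fun s => pumpSolution ε 1 s 1) (ε * pumpSolution ε 1 t 0 ^ 2) t := by
    simpa [pumpGate] using hasDerivAt_pi.1 hp 1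
  refine hasDerivAt_pi.2 fun i => ?_
  fin_cases i
  · simpa [seedFreeOrbit] using h0
  · simpa [seedFreeOrbit] using h1
  · simpa [seedFreeOrbit] using hasDerivAt_const t (0 : ℝ)
  · simpa [seedFreeOrbit] using hasDerivAt_const t (0 : ℝ)
  · simpa [seedFreeOrbit] using hasDerivAt_const t (0 : ℝ)

/-- The delay circuit (5.5) evaluated along the seed-free orbit: the free pump field plus the seed
term `ε²e^{-K¹⁰}a²` in the `c`-slot. [cite: Tao2016AveragedNS, §5.5 (5.5)] -/
theorem delayCircuit_seedFreeOrbit (K ε t : ℝ) :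
    delayCircuit K ε (seedFreeOrbit ε t) =
      ![-(ε * seedFreeOrbit ε t 0 * seedFreeOrbit ε t 1), ε * seedFreeOrbit ε t 0 ^ 2,
        ε ^ 2 * exp (-K ^ 10) * seedFreeOrbit ε t 0 ^ 2, 0, 0] := by
  ext i
  fin_cases i <;> simp [delayCircuit, seedFreeOrbit]

/-- THE DEFECT of the seed-free orbit with respect to (5.5): velocity minus field is
`-ε²e^{-K¹⁰}a²` in the `c`-slot and zero elsewhere — the adversarial forcing that cancels the seed.
[cite: Tao2016AveragedNS, §5.5 (5.5)] -/
theorem seedFreeOrbit_defect (K ε t : ℝ) :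
    ![-(ε * seedFreeOrbit ε t 0 * seedFreeOrbit ε t 1), ε * seedFreeOrbit ε t 0 ^ 2, (0 : ℝ), 0, 0]
        - delayCircuit K ε (seedFreeOrbit ε t) =
      ![0, 0, -(ε ^ 2 * exp (-K ^ 10) * seedFreeOrbit ε t 0 ^ 2), 0, 0] := by
  rw [delayCircuit_seedFreeOrbit]
  ext i
  fin_cases i <;> simp

/-- The defect has sup-size at most the seed rate `ε²e^{-K¹⁰}` (as `a² ≤ 1`).
[cite: Tao2016AveragedNS, §5.5 (5.5)] -/
theorem norm_seedFreeOrbit_defect_le (K ε t : ℝ) :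
    ‖![-(ε * seedFreeOrbit ε t 0 * seedFreeOrbit ε t 1), ε * seedFreeOrbit ε t 0 ^ 2, (0 : ℝ), 0, 0]
        - delayCircuit K ε (seedFreeOrbit ε t)‖ ≤ ε ^ 2 * exp (-K ^ 10) := by
  rw [seedFreeOrbit_defect]
  have hs : 0 ≤ ε ^ 2 * exp (-K ^ 10) := by positivity
  have hx : seedFreeOrbit ε t 0 ^ 2 ≤ 1 := by
    nlinarith [seedFreeOrbit_sq_add_sq ε t, sq_nonneg (seedFreeOrbit ε t 1)]
  have hkey : |-(ε ^ 2 * exp (-K ^ 10) * seedFreeOrbit ε t 0 ^ 2)| ≤ ε ^ 2 * exp (-K ^ 10) := by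
    rw [abs_neg, abs_of_nonneg (by positivity)]
    exact mul_le_of_le_one_right hs hx
  refine (pi_norm_le_iff_of_nonneg hs).2 fun i => ?_
  rw [Real.norm_eq_abs]
  fin_cases i
  · simpa using hs
  · simpa using hs
  · simpa using hkey
  · simpa using hs
  · simpa using hs

/-- **The seed-free orbit is an `ε²e^{-K¹⁰}`-pseudo-orbit of (5.5)** on every window, in every
sup-ball of radius `≥ 1`, issued exactly from (5.6). [cite: HairerNorsettWanner1993, §I.10] -/
theorem seedFreeOrbit_isPseudoOrbit (K ε T : ℝ) {R : ℝ≥0} (hR : 1 ≤ R) :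
    IsPseudoOrbit (delayCircuit K ε) (ε ^ 2 * exp (-K ^ 10)) R T (seedFreeOrbit ε) where
  continuousOn := fun t _ => (hasDerivAt_seedFreeOrbit ε t).continuousAt.continuousWithinAt
  defect := fun t _ =>
    ⟨_, (hasDerivAt_seedFreeOrbit ε t).hasDerivWithinAt, norm_seedFreeOrbit_defect_le K ε t⟩
  norm_le := fun t _ => (seedFreeOrbit_norm_le ε t).trans (by exact_mod_cast hR)

/-! ## The robustness predicate and the sufficient radius (from `CircuitShadowing.lean`) -/

/-- **"The gate fires on the forcing budget `r`"** (window `[0,T]`, sup-ball `R`, constants `C, K`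
of Theorem 5.3, efficiency loss `θ`): EVERY pseudo-orbit `Y` of (5.5) with defect `δ ≥ 0`, issued
`δ₀`-close to (5.6), with `δ₀ + δT ≤ r`, exhibits the delayed abrupt transition in the form of
`IsPseudoOrbit.fires_of_budget` — in particular its output mode is `≥ 1 - CK⁻¹⁰ - θ` on
`[t_c + K^{-1/2}, T]` for some `t_c` with `|t_c - √2| ≤ C/√K`.
[cite: Tao2016AveragedNS, Theorem 5.3] -/
def FiresOnBudget (K ε : ℝ) (R : ℝ≥0) (T C θ r : ℝ) : Prop :=
  ∀ (δ δ₀ : ℝ) (Y : ℝ → Fin 5 → ℝ), IsPseudoOrbit (delayCircuit K ε) δ R T Y →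
    ‖Y 0 - delayInit‖ ≤ δ₀ → 0 ≤ δ → δ₀ + δ * T ≤ r →
    ∃ tc : ℝ, |tc - Real.sqrt 2| ≤ C / Real.sqrt K ∧
      (∀ t ∈ Icc 0 T, t ≤ tc - 1 / Real.sqrt K →
        |Y t 0 - 1| ≤ C / K ^ 10 + θ ∧ ∀ i : Fin 5, i ≠ 0 → |Y t i| ≤ C / K ^ 10 + θ) ∧
      (∀ t ∈ Icc 0 T, tc + 1 / Real.sqrt K ≤ t →
        1 - C / K ^ 10 - θ ≤ Y t 4 ∧ ∀ i : Fin 5, i ≠ 4 → |Y t i| ≤ C / K ^ 10 + θ)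

/-- `FiresOnBudget` is antitone in the budget. [folklore] -/
theorem FiresOnBudget.anti {K ε T C θ r r' : ℝ} {R : ℝ≥0} (h : FiresOnBudget K ε R T C θ r)
    (hr : r' ≤ r) : FiresOnBudget K ε R T C θ r' :=
  fun δ δ₀ Y hY h0 hδ hb => h δ δ₀ Y hY h0 hδ (hb.trans hr)

/-- **The sufficient radius** (restated from `CircuitShadowing.lean`): granted Theorem 5.3 for the
reference trajectory, the gate fires on the budget `shadowRadius K ε R T θ = θe^{-LT}`.
[cite: HairerNorsettWanner1993, Thm I.10.2] -/
theorem firesOnBudget_shadowRadius {K ε T C θ : ℝ} {R : ℝ≥0} (hR : 1 ≤ R)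
    (hX : HasAbruptTransition C K (delaySolution K ε)) :
    FiresOnBudget K ε R T C θ (shadowRadius K ε R T θ) :=
  fun _ _ _ hY h0 hδ hb => hY.fires_of_le_shadowRadius hR h0 hδ hX hb

/-- Arithmetic of the observation time: `|t_c - √2| ≤ C/√K` and `√2 + (C+1)/√K ≤ T₀` give
`t_c + 1/√K ≤ T₀`. [folklore] -/
theorem tc_add_le {tc C K T₀ : ℝ} (htc : |tc - Real.sqrt 2| ≤ C / Real.sqrt K)
    (hT : Real.sqrt 2 + (C + 1) / Real.sqrt K ≤ T₀) : tc + 1 / Real.sqrt K ≤ T₀ := by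
  have h1 : tc ≤ Real.sqrt 2 + C / Real.sqrt K := by
    have := (abs_sub_le_iff.1 htc).1; linarith
  have h2 : C / Real.sqrt K + 1 / Real.sqrt K = (C + 1) / Real.sqrt K := by rw [add_div]
  linarith

/-- **Necessity, seed channel.** No firing statement survives a forcing budget `r ≥ ε²e^{-K¹⁰}·T`
(window long enough to contain the observation time `√2 + (C+1)/√K`, tolerance `CK⁻¹⁰ + θ < 1`):
the seed-free orbit is an admissible pseudo-orbit whose output is `0` at time `T`. So the
defect-robustness radius of the gate is at most its own seed rate. [cite: Tao2016AveragedNS, §5.5] -/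
theorem not_firesOnBudget_of_seed_mul_le {K ε T C θ r : ℝ} {R : ℝ≥0} (hR : 1 ≤ R) (hC : 0 ≤ C)
    (hT : Real.sqrt 2 + (C + 1) / Real.sqrt K ≤ T) (hθ : C / K ^ 10 + θ < 1)
    (hr : ε ^ 2 * exp (-K ^ 10) * T ≤ r) : ¬ FiresOnBudget K ε R T C θ r := by
  intro h
  have hT0 : 0 ≤ T := by
    have : 0 ≤ (C + 1) / Real.sqrt K := div_nonneg (by linarith) (Real.sqrt_nonneg _)
    linarith [Real.sqrt_nonneg 2]
  obtain ⟨tc, htc, -, hafter⟩ := h (ε ^ 2 * exp (-K ^ 10)) 0 (seedFreeOrbit ε)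
    (seedFreeOrbit_isPseudoOrbit K ε T hR) (by rw [seedFreeOrbit_zero, sub_self, norm_zero])
    (by positivity) (by simpa using hr)
  have := (hafter T ⟨hT0, le_rfl⟩ (tc_add_le htc hT)).1
  rw [seedFreeOrbit_output] at this
  linarith

/-! ## B. The pump-bias channel: a kick of size `2ε` in `b` re-times the gate (exact dynamics) -/

/-- The **biased datum** `(√(1-β²), -β, 0, 0, 0)`: energy one, pump variable `b` pre-loaded to `-β`.
[cite: Tao2016AveragedNS, §5.5 (5.6)] -/
def biasInit (β : ℝ) : Fin 5 → ℝ := ![Real.sqrt (1 - β ^ 2), -β, 0, 0, 0]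

/-- The biased datum has energy one (`β² ≤ 1`). [cite: Tao2016AveragedNS, §5.5 (energy-con)] -/
theorem energy_biasInit {β : ℝ} (hβ : β ^ 2 ≤ 1) : energy (biasInit β) = 1 := by
  have h : 0 ≤ 1 - β ^ 2 := by linarith
  simp [energy, Fin.sum_univ_five, biasInit, Real.sq_sqrt h]

/-- The biased datum differs from (5.6) by `(√(1-β²) - 1, -β, 0, 0, 0)`.
[cite: Tao2016AveragedNS, §5.5 (5.6)] -/
theorem biasInit_sub_delayInit (β : ℝ) :
    biasInit β - delayInit = ![Real.sqrt (1 - β ^ 2) - 1, -β, 0, 0, 0] := by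
  ext i
  fin_cases i <;> simp [biasInit, delayInit]

/-- The biased datum is within sup-distance `β` of (5.6) (`0 ≤ β ≤ 1`; indeed
`1 - √(1-β²) ≤ β`). [cite: Tao2016AveragedNS, §5.5 (5.6)] -/
theorem norm_biasInit_sub_delayInit {β : ℝ} (hβ0 : 0 ≤ β) (hβ1 : β ≤ 1) :
    ‖biasInit β - delayInit‖ ≤ β := by
  have hlow : 1 - β ≤ Real.sqrt (1 - β ^ 2) := by
    calc 1 - β = Real.sqrt ((1 - β) ^ 2) := (Real.sqrt_sq (by linarith)).symm
      _ ≤ Real.sqrt (1 - β ^ 2) := Real.sqrt_le_sqrt (by nlinarith)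
  rw [biasInit_sub_delayInit]
  refine (pi_norm_le_iff_of_nonneg hβ0).2 fun i => ?_
  rw [Real.norm_eq_abs]
  have hup : Real.sqrt (1 - β ^ 2) ≤ 1 := by
    simpa using Real.sqrt_le_sqrt (show 1 - β ^ 2 ≤ 1 by nlinarith)
  have h0 : |Real.sqrt (1 - β ^ 2) - 1| ≤ β := by
    rw [abs_sub_comm, abs_of_nonneg (by linarith)]; linarith
  have h1 : |-β| ≤ β := by rw [abs_neg, abs_of_nonneg hβ0]
  fin_cases i
  · simpa using h0
  · simpa using h1
  · simpa using hβ0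
  · simpa using hβ0
  · simpa using hβ0

/-- A global solution of (5.5) from the biased datum exists (energy is conserved, the field is
polynomial). [cite: Tao2016AveragedNS, §5 (ode)–(g-cancel)] -/
theorem exists_solution_biasInit (K ε β : ℝ) :
    ∃ X : ℝ → Fin 5 → ℝ, X 0 = biasInit β ∧ ∀ t, HasDerivAt X (delayCircuit K ε (X t)) t :=
  (isCancelling_delayCircuit K ε).exists_solution (contDiff_delayCircuit K ε) _

section Bias

variable {K ε β : ℝ} {X : ℝ → Fin 5 → ℝ}

/-- Energy conservation along the kicked trajectory. [cite: Tao2016AveragedNS, §5.5 (energy-con)] -/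
theorem bias_energy (hX : ∀ t, HasDerivAt X (delayCircuit K ε (X t)) t) (h0 : X 0 = biasInit β)
    (hβ : β ^ 2 ≤ 1) (t : ℝ) : energy (X t) = 1 := by
  rw [energy_eq_of_isCancelling (isCancelling_delayCircuit K ε) hX t 0, h0, energy_biasInit hβ]

/-- Each mode of the kicked trajectory has square at most one. [cite: Tao2016AveragedNS, §5.5] -/
theorem bias_sq_le_one (hX : ∀ t, HasDerivAt X (delayCircuit K ε (X t)) t)
    (h0 : X 0 = biasInit β) (hβ : β ^ 2 ≤ 1) (t : ℝ) (i : Fin 5) : X t i ^ 2 ≤ 1 := by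
  have h := bias_energy hX h0 hβ t
  rw [energy] at h
  rw [← h]
  exact Finset.single_le_sum (f := fun j => X t j ^ 2) (fun j _ => sq_nonneg _) (Finset.mem_univ i)

/-- Each mode of the kicked trajectory is bounded by one; the trajectory stays in the unit sup-ball.
[cite: Tao2016AveragedNS, §5.5] -/
theorem bias_norm_le_one (hX : ∀ t, HasDerivAt X (delayCircuit K ε (X t)) t)
    (h0 : X 0 = biasInit β) (hβ : β ^ 2 ≤ 1) (t : ℝ) : ‖X t‖ ≤ 1 := by
  have := norm_le_sqrt_energy (X t)
  rwa [bias_energy hX h0 hβ t, Real.sqrt_one] at this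

/-- Initial values of the kicked trajectory. [cite: Tao2016AveragedNS, §5.5 (5.6)] -/
theorem bias_init_b (h0 : X 0 = biasInit β) : X 0 1 = -β := by simp [h0, biasInit]

/-- Initial values of the kicked trajectory. [cite: Tao2016AveragedNS, §5.5 (5.6)] -/
theorem bias_init_c (h0 : X 0 = biasInit β) : X 0 2 = 0 := by simp [h0, biasInit]

/-- Initial values of the kicked trajectory. [cite: Tao2016AveragedNS, §5.5 (5.6)] -/
theorem bias_init_d (h0 : X 0 = biasInit β) : X 0 3 = 0 := by simp [h0, biasInit]

/-- Initial values of the kicked trajectory. [cite: Tao2016AveragedNS, §5.5 (5.6)] -/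
theorem bias_init_e (h0 : X 0 = biasInit β) : X 0 4 = 0 := by simp [h0, biasInit]

/-- **The pump variable stays biased**: `b(t) ≤ -β + εt` for `t ≥ 0`, because
`∂ₜb = εa² - ε⁻¹K¹⁰c² ≤ ε` (energy: `a² ≤ 1`). [cite: Tao2016AveragedNS, §5.5 (5.5) b-equation] -/
theorem bias_b_le (hX : ∀ t, HasDerivAt X (delayCircuit K ε (X t)) t) (h0 : X 0 = biasInit β)
    (hβ : β ^ 2 ≤ 1) (hε : 0 ≤ ε) {t : ℝ} (ht : 0 ≤ t) : X t 1 ≤ -β + ε * t := by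
  have hanti := Thm53.antitoneOn_sub_of_deriv_le (convex_Ici 0)
    (fun s _ => Thm53.hasDerivAt_b hX s) (fun s _ => (hasDerivAt_id s).const_mul ε)
    (fun s _ => by
      have ha : X s 0 ^ 2 ≤ 1 := bias_sq_le_one hX h0 hβ s 0
      have h1 : ε * X s 0 ^ 2 ≤ ε := by simpa using mul_le_mul_of_nonneg_left ha hε
      have h2 : 0 ≤ ε⁻¹ * K ^ 10 * X s 2 ^ 2 := by
        have : 0 ≤ ε⁻¹ := inv_nonneg.2 hε
        positivity
      simpa using (show ε * X s 0 ^ 2 - ε⁻¹ * K ^ 10 * X s 2 ^ 2 ≤ ε by linarith))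
  have hmono := hanti (self_mem_Ici (a := (0 : ℝ))) (mem_Ici.2 ht) ht
  simp only [bias_init_b h0, id, mul_zero, sub_zero] at hmono
  linarith

/-- On `[0, β/ε]` the pump variable is non-positive: the amplifier `b → c` is switched off.
[cite: Tao2016AveragedNS, §5.5 proof (sign of `b`)] -/
theorem bias_b_nonpos (hX : ∀ t, HasDerivAt X (delayCircuit K ε (X t)) t) (h0 : X 0 = biasInit β)
    (hβ : β ^ 2 ≤ 1) (hε : 0 < ε) {t : ℝ} (ht : t ∈ Icc 0 (β / ε)) : X t 1 ≤ 0 := by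
  have h := bias_b_le hX h0 hβ hε.le ht.1
  have : ε * t ≤ β := by
    have := mul_le_mul_of_nonneg_left ht.2 hε.le
    rwa [mul_div_cancel₀ _ hε.ne'] at this
  linarith

/-- **`c` collects only the seed**: `|c(t)| ≤ ε²e^{-K¹⁰}·t` on `[0, β/ε]`, since with `b ≤ 0` the
amplifier term damps and `∂ₜ|c| ≤ ε²e^{-K¹⁰}a² ≤ ε²e^{-K¹⁰}` (comparison for `√(c² + μ²)`, `μ ↓ 0`).
[cite: Tao2016AveragedNS, §5.5 (5.5) c-equation] -/
theorem bias_abs_c_le (hX : ∀ t, HasDerivAt X (delayCircuit K ε (X t)) t) (h0 : X 0 = biasInit β)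
    (hβ : β ^ 2 ≤ 1) (hε : 0 < ε) {t : ℝ} (ht : t ∈ Icc 0 (β / ε)) :
    |X t 2| ≤ ε ^ 2 * exp (-K ^ 10) * t := by
  refine le_of_forall_pos_le_add fun μ hμ => ?_
  set σ : ℝ := ε ^ 2 * exp (-K ^ 10) with hσ
  have hσ0 : 0 ≤ σ := by positivity
  set h : ℝ → ℝ := fun s => sqrt (X s 2 ^ 2 + μ ^ 2) with hh
  have hpos : ∀ s, 0 < X s 2 ^ 2 + μ ^ 2 := fun s => by positivity
  have hc_le : ∀ s, |X s 2| ≤ h s := fun s => abs_le_sqrt (by nlinarith [sq_nonneg μ])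
  have hcsq : ∀ s, HasDerivAt (fun s => X s 2 ^ 2 + μ ^ 2)
      (2 * X s 2 * (σ * X s 0 ^ 2 + ε⁻¹ * K ^ 10 * X s 1 * X s 2)) s := fun s => by
    refine (((Thm53.hasDerivAt_c hX s).fun_pow 2).add_const (μ ^ 2)).congr_deriv ?_
    simp only [show (2 : ℕ) - 1 = 1 from rfl, pow_one, Nat.cast_ofNat, hσ]
  have hder : ∀ s, HasDerivAt h
      ((2 * X s 2 * (σ * X s 0 ^ 2 + ε⁻¹ * K ^ 10 * X s 1 * X s 2)) / (2 * sqrt (X s 2 ^ 2 + μ ^ 2)))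
      s := fun s => (hcsq s).sqrt (hpos s).ne'
  have hbound : ∀ s ∈ Icc 0 (β / ε),
      (2 * X s 2 * (σ * X s 0 ^ 2 + ε⁻¹ * K ^ 10 * X s 1 * X s 2)) / (2 * sqrt (X s 2 ^ 2 + μ ^ 2))
        ≤ σ := by
    intro s hs
    have hhpos : 0 < sqrt (X s 2 ^ 2 + μ ^ 2) := sqrt_pos.2 (hpos s)
    rw [div_le_iff₀ (by positivity)]
    have ha : X s 0 ^ 2 ≤ 1 := bias_sq_le_one hX h0 hβ s 0
    have ha0 : 0 ≤ X s 0 ^ 2 := sq_nonneg _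
    have hb : X s 1 ≤ 0 := bias_b_nonpos hX h0 hβ hε hs
    have hcs : |X s 2| ≤ h s := hc_le s
    have hc1 : X s 2 ≤ h s := (le_abs_self _).trans hcs
    have hc2 : -h s ≤ X s 2 := by have := neg_abs_le (X s 2); linarith
    have hh0 : 0 ≤ h s := (abs_nonneg _).trans hcs
    have hεK : 0 ≤ ε⁻¹ * K ^ 10 := by positivity
    have h1 : X s 0 ^ 2 * X s 2 ≤ h s := by nlinarith
    have h2 : ε⁻¹ * K ^ 10 * X s 1 * X s 2 ^ 2 ≤ 0 := by
      have := mul_nonneg hεK (sq_nonneg (X s 2))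
      nlinarith
    have : h s = sqrt (X s 2 ^ 2 + μ ^ 2) := rfl
    rw [← this]
    nlinarith [mul_le_mul_of_nonneg_left h1 hσ0]
  have hanti := Thm53.antitoneOn_sub_of_deriv_le (convex_Icc 0 (β / ε)) (fun s _ => hder s)
    (fun s _ => (hasDerivAt_id s).const_mul σ) (fun s hs => by simpa using hbound s hs)
  have hT0 : 0 ≤ β / ε := ht.1.trans ht.2
  have h0mem : (0 : ℝ) ∈ Icc (0 : ℝ) (β / ε) := ⟨le_rfl, hT0⟩
  have hmono := hanti h0mem ht ht.1
  have hh0 : h 0 = μ := by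
    simp only [hh, bias_init_c h0]
    simpa using sqrt_sq hμ.le
  simp only [hh0, id, mul_zero, sub_zero] at hmono
  have : h t ≤ σ * t + μ := by linarith
  exact (hc_le t).trans this

/-- **The output pair stays asleep**: `√(d² + ã²) ≤ e^{-K¹⁰}t²/2` on `[0, β/ε]`, since only the
rotor `∂ₜ(d²+ã²) = 2ε⁻²cad` feeds it and `|c| ≤ ε²e^{-K¹⁰}t`, `|a| ≤ 1`.
[cite: Tao2016AveragedNS, §5.5 (5.5) d,ã-equations] -/
theorem bias_out_le (hX : ∀ t, HasDerivAt X (delayCircuit K ε (X t)) t) (h0 : X 0 = biasInit β)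
    (hβ : β ^ 2 ≤ 1) (hε : 0 < ε) {t : ℝ} (ht : t ∈ Icc 0 (β / ε)) :
    Real.sqrt (X t 3 ^ 2 + X t 4 ^ 2) ≤ exp (-K ^ 10) / 2 * t ^ 2 := by
  refine le_of_forall_pos_le_add fun μ hμ => ?_
  set g : ℝ → ℝ := fun s => sqrt (X s 3 ^ 2 + X s 4 ^ 2 + μ ^ 2) with hg
  have hpos : ∀ s, 0 < X s 3 ^ 2 + X s 4 ^ 2 + μ ^ 2 := fun s => by positivity
  have hd_le : ∀ s, |X s 3| ≤ g s := fun s =>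
    abs_le_sqrt (by nlinarith [sq_nonneg μ, sq_nonneg (X s 4)])
  have hout_le : ∀ s, Real.sqrt (X s 3 ^ 2 + X s 4 ^ 2) ≤ g s := fun s =>
    Real.sqrt_le_sqrt (by nlinarith [sq_nonneg μ])
  have hder : ∀ s, HasDerivAt g
      ((2 * (ε ^ 2)⁻¹ * X s 2 * X s 0 * X s 3) / (2 * sqrt (X s 3 ^ 2 + X s 4 ^ 2 + μ ^ 2))) s :=
    fun s => ((delayCircuit_out_energy (hX s)).add_const (μ ^ 2)).sqrt (hpos s).ne'
  have hΦ : ∀ s, HasDerivAt (fun s : ℝ => exp (-K ^ 10) / 2 * s ^ 2) (exp (-K ^ 10) * s) s := by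
    intro s
    refine ((hasDerivAt_pow 2 s).const_mul (exp (-K ^ 10) / 2)).congr_deriv ?_
    simp only [show (2 : ℕ) - 1 = 1 from rfl, pow_one, Nat.cast_ofNat]
    ring
  have hbound : ∀ s ∈ Icc 0 (β / ε),
      (2 * (ε ^ 2)⁻¹ * X s 2 * X s 0 * X s 3) / (2 * sqrt (X s 3 ^ 2 + X s 4 ^ 2 + μ ^ 2))
        ≤ exp (-K ^ 10) * s := by
    intro s hs
    have hgpos : 0 < sqrt (X s 3 ^ 2 + X s 4 ^ 2 + μ ^ 2) := sqrt_pos.2 (hpos s)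
    rw [div_le_iff₀ (by positivity)]
    have hs0 : 0 ≤ s := hs.1
    have hc : |X s 2| ≤ ε ^ 2 * exp (-K ^ 10) * s := bias_abs_c_le hX h0 hβ hε hs
    have ha : |X s 0| ≤ 1 := (sq_le_one_iff_abs_le_one _).1 (bias_sq_le_one hX h0 hβ s 0)
    have hd : |X s 3| ≤ g s := hd_le s
    have hε2 : (0 : ℝ) < (ε ^ 2)⁻¹ := by positivity
    have habs : |(ε ^ 2)⁻¹ * X s 2 * X s 0 * X s 3| ≤ exp (-K ^ 10) * s * g s := by
      calc |(ε ^ 2)⁻¹ * X s 2 * X s 0 * X s 3|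
          = (ε ^ 2)⁻¹ * (|X s 2| * |X s 0| * |X s 3|) := by
            rw [abs_mul, abs_mul, abs_mul, abs_of_pos hε2]; ring
        _ ≤ (ε ^ 2)⁻¹ * ((ε ^ 2 * exp (-K ^ 10) * s) * 1 * g s) := by gcongr
        _ = exp (-K ^ 10) * s * g s := by field_simp
    have : g s = sqrt (X s 3 ^ 2 + X s 4 ^ 2 + μ ^ 2) := rfl
    rw [← this]
    linarith [le_abs_self ((ε ^ 2)⁻¹ * X s 2 * X s 0 * X s 3)]
  have hanti := Thm53.antitoneOn_sub_of_deriv_le (convex_Icc 0 (β / ε)) (fun s _ => hder s)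
    (fun s _ => hΦ s) (fun s hs => hbound s hs)
  have hT0 : 0 ≤ β / ε := ht.1.trans ht.2
  have h0mem : (0 : ℝ) ∈ Icc (0 : ℝ) (β / ε) := ⟨le_rfl, hT0⟩
  have hmono := hanti h0mem ht ht.1
  have hg0 : g 0 = μ := by
    simp only [hg, bias_init_d h0, bias_init_e h0]
    simpa using sqrt_sq hμ.le
  simp only [hg0] at hmono
  have : g t ≤ exp (-K ^ 10) / 2 * t ^ 2 + μ := by
    have h00 : exp (-K ^ 10) / 2 * (0 : ℝ) ^ 2 = 0 := by ring
    rw [h00, sub_zero] at hmono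
    linarith
  exact (hout_le t).trans this

/-- **The output is still (essentially) zero at time `2`** when the bias is at least `2ε`:
`|ã(t)| ≤ 2e^{-K¹⁰}` and `|d(t)| ≤ 2e^{-K¹⁰}` on `[0,2]`. [cite: Tao2016AveragedNS, §5.5] -/
theorem bias_output_small (hX : ∀ t, HasDerivAt X (delayCircuit K ε (X t)) t)
    (h0 : X 0 = biasInit β) (hβ1 : β ≤ 1) (hε : 0 < ε) (hβ2 : 2 * ε ≤ β) {t : ℝ}
    (ht : t ∈ Icc 0 2) : |X t 4| ≤ 2 * exp (-K ^ 10) ∧ |X t 3| ≤ 2 * exp (-K ^ 10) := by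
  have hβ0 : 0 ≤ β := by linarith
  have hβ : β ^ 2 ≤ 1 := by nlinarith
  have h2 : (2 : ℝ) ≤ β / ε := by rwa [le_div_iff₀ hε]
  have ht' : t ∈ Icc 0 (β / ε) := ⟨ht.1, ht.2.trans h2⟩
  have hg := bias_out_le hX h0 hβ hε ht'
  have he : |X t 4| ≤ Real.sqrt (X t 3 ^ 2 + X t 4 ^ 2) :=
    abs_le_sqrt (by nlinarith [sq_nonneg (X t 3)])
  have hd : |X t 3| ≤ Real.sqrt (X t 3 ^ 2 + X t 4 ^ 2) :=
    abs_le_sqrt (by nlinarith [sq_nonneg (X t 4)])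
  have hE : 0 ≤ exp (-K ^ 10) := (exp_pos _).le
  have hbnd : exp (-K ^ 10) / 2 * t ^ 2 ≤ 2 * exp (-K ^ 10) := by
    have : t ^ 2 ≤ 4 := by nlinarith [ht.1, ht.2]
    nlinarith
  exact ⟨he.trans (hg.trans hbnd), hd.trans (hg.trans hbnd)⟩

/-- **The kicked trajectory does not perform the designed abrupt transition.** For a bias
`2ε ≤ β ≤ 1`, `K` large enough that the observation time `√2 + (C+1)/√K ≤ 2` and the tolerance
`CK⁻¹⁰ + 2e^{-K¹⁰} < 1`, NO global solution of (5.5) from `biasInit β` satisfies the conclusion of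
Theorem 5.3 with constants `C, K` (its output is `≤ 2e^{-K¹⁰}` at `t = 2 ≥ t_c + K^{-1/2}`, where
`≥ 1 - CK⁻¹⁰` is demanded). [cite: Tao2016AveragedNS, Theorem 5.3] -/
theorem not_hasAbruptTransition_of_bias {C : ℝ} (hX : ∀ t, HasDerivAt X (delayCircuit K ε (X t)) t)
    (h0 : X 0 = biasInit β) (hβ1 : β ≤ 1) (hε : 0 < ε) (hβ2 : 2 * ε ≤ β)
    (hCK : Real.sqrt 2 + (C + 1) / Real.sqrt K ≤ 2) (htol : C / K ^ 10 + 2 * exp (-K ^ 10) < 1) :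
    ¬ HasAbruptTransition C K X := by
  rintro ⟨tc, htc, -, hafter⟩
  have h2 := (hafter 2 (tc_add_le htc hCK)).1
  have hout := (bias_output_small hX h0 hβ1 hε hβ2 (t := 2) ⟨by norm_num, le_rfl⟩).1
  have h3 := (abs_sub_le_iff.1 h2).2
  have h4 := (abs_le.1 hout).2
  linarith

end Bias

/-- **Kick fragility of Theorem 5.3's conclusion.** For every bias `β ∈ [2ε, 1]` there is a global
solution of (5.5) issued within sup-distance `β` of (5.6), staying in the unit ball, that does NOT
have the delayed abrupt transition with constants `C, K` (`K` as in
`not_hasAbruptTransition_of_bias`). [cite: Tao2016AveragedNS, Theorem 5.3] -/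
theorem exists_near_not_hasAbruptTransition {K ε β C : ℝ} (hε : 0 < ε) (hβ2 : 2 * ε ≤ β)
    (hβ1 : β ≤ 1) (hCK : Real.sqrt 2 + (C + 1) / Real.sqrt K ≤ 2)
    (htol : C / K ^ 10 + 2 * exp (-K ^ 10) < 1) :
    ∃ X : ℝ → Fin 5 → ℝ, (∀ t, HasDerivAt X (delayCircuit K ε (X t)) t) ∧
      ‖X 0 - delayInit‖ ≤ β ∧ (∀ t, ‖X t‖ ≤ 1) ∧ ¬ HasAbruptTransition C K X := by
  obtain ⟨X, h0, hX⟩ := exists_solution_biasInit K ε β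
  have hβ0 : 0 ≤ β := by linarith
  have hβ : β ^ 2 ≤ 1 := by nlinarith
  exact ⟨X, hX, h0 ▸ norm_biasInit_sub_delayInit hβ0 hβ1, bias_norm_le_one hX h0 hβ,
    not_hasAbruptTransition_of_bias hX h0 hβ1 hε hβ2 hCK htol⟩

/-- **Necessity, pump-bias channel.** No firing statement survives a budget `r ≥ 2ε` (window
`T ≥ 2`, `2ε ≤ 1`, `K` large as above, tolerance `CK⁻¹⁰ + θ + 2e^{-K¹⁰} < 1`): the kicked exact
trajectory is a `0`-pseudo-orbit issued `2ε`-close to (5.6) whose output at time `2` is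
`≤ 2e^{-K¹⁰}`. So the (timing-faithful) kick-robustness radius of the gate is `< 2ε`.
[cite: Tao2016AveragedNS, Theorem 5.3] -/
theorem not_firesOnBudget_of_two_mul_eps_le {K ε T C θ r : ℝ} {R : ℝ≥0} (hR : 1 ≤ R) (hε : 0 < ε)
    (hε1 : 2 * ε ≤ 1) (hCK : Real.sqrt 2 + (C + 1) / Real.sqrt K ≤ 2) (hT : 2 ≤ T)
    (htol : C / K ^ 10 + θ + 2 * exp (-K ^ 10) < 1) (hr : 2 * ε ≤ r) :
    ¬ FiresOnBudget K ε R T C θ r := by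
  intro h
  obtain ⟨X, h0, hX⟩ := exists_solution_biasInit K ε (2 * ε)
  have hβ : (2 * ε) ^ 2 ≤ 1 := by nlinarith
  have hPO : IsPseudoOrbit (delayCircuit K ε) 0 R T X :=
    IsPseudoOrbit.of_hasDerivAt hX fun t _ =>
      (bias_norm_le_one hX h0 hβ t).trans (by exact_mod_cast hR)
  have hinit : ‖X 0 - delayInit‖ ≤ 2 * ε := by
    rw [h0]; exact norm_biasInit_sub_delayInit (by linarith) hε1
  obtain ⟨tc, htc, -, hafter⟩ := h 0 (2 * ε) X hPO hinit le_rfl (by simpa using hr)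
  have h2 := (hafter 2 ⟨by norm_num, hT⟩ (tc_add_le htc hCK)).1
  have hout := (bias_output_small hX h0 hε1 hε le_rfl (t := 2) ⟨by norm_num, le_rfl⟩).1
  have h4 := (abs_le.1 hout).2
  linarith

/-! ## C. The sandwich: sufficient radius < necessary thresholds -/

/-- Granted Theorem 5.3 for the reference trajectory, the Grönwall radius is below the seed budget:
`shadowRadius K ε R T θ < ε²e^{-K¹⁰}·T`. [cite: Tao2016AveragedNS, Theorem 5.3] -/
theorem shadowRadius_lt_seed_mul {K ε T C θ : ℝ} {R : ℝ≥0} (hR : 1 ≤ R) (hC : 0 ≤ C)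
    (hT : Real.sqrt 2 + (C + 1) / Real.sqrt K ≤ T) (hθ : C / K ^ 10 + θ < 1)
    (hX : HasAbruptTransition C K (delaySolution K ε)) :
    shadowRadius K ε R T θ < ε ^ 2 * exp (-K ^ 10) * T := by
  by_contra hle
  exact not_firesOnBudget_of_seed_mul_le hR hC hT hθ (not_lt.1 hle)
    (firesOnBudget_shadowRadius hR hX)

/-- Granted Theorem 5.3 for the reference trajectory, the Grönwall radius is below the pump-bias
kick: `shadowRadius K ε R T θ < 2ε`. [cite: Tao2016AveragedNS, Theorem 5.3] -/
theorem shadowRadius_lt_two_mul_eps {K ε T C θ : ℝ} {R : ℝ≥0} (hR : 1 ≤ R) (hε : 0 < ε)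
    (hε1 : 2 * ε ≤ 1) (hCK : Real.sqrt 2 + (C + 1) / Real.sqrt K ≤ 2) (hT : 2 ≤ T)
    (htol : C / K ^ 10 + θ + 2 * exp (-K ^ 10) < 1)
    (hX : HasAbruptTransition C K (delaySolution K ε)) : shadowRadius K ε R T θ < 2 * ε := by
  by_contra hle
  exact not_firesOnBudget_of_two_mul_eps_le hR hε hε1 hCK hT htol (not_lt.1 hle)
    (firesOnBudget_shadowRadius hR hX)

/-- **Gate fragility, unconditional form.** With the absolute constant `C` and the threshold `K₀`
of the tree's proof of Theorem 5.3 (`delaySolution_hasAbruptTransition`): for every `K ≥ K₀` whose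
observation time obeys `√2 + (C+1)/√K ≤ 2` there is `ε₁ > 0` such that for `0 < ε ≤ ε₁` with
`2ε ≤ 1`, every sup-ball `R ≥ 1`, every window `T ≥ 2` and every efficiency loss `θ` with
`CK⁻¹⁰ + θ + 2e^{-K¹⁰} < 1`, the gate (5.5) FIRES on the forcing budget `shadowRadius K ε R T θ`
but on NO budget `≥ ε²e^{-K¹⁰}·T` (seed channel) and on NO budget `≥ 2ε` (pump-bias channel).
[cite: Tao2016AveragedNS, Theorem 5.3] -/
theorem gate_fragility :
    ∃ C : ℝ, 0 < C ∧ ∃ K₀ : ℝ, 0 < K₀ ∧ ∀ K : ℝ, K₀ ≤ K →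
      Real.sqrt 2 + (C + 1) / Real.sqrt K ≤ 2 → ∃ ε₁ : ℝ, 0 < ε₁ ∧
        ∀ ε : ℝ, 0 < ε → ε ≤ ε₁ → 2 * ε ≤ 1 → ∀ (R : ℝ≥0), 1 ≤ R → ∀ T θ : ℝ, 2 ≤ T →
          C / K ^ 10 + θ + 2 * exp (-K ^ 10) < 1 →
            FiresOnBudget K ε R T C θ (shadowRadius K ε R T θ) ∧
            (∀ r, ε ^ 2 * exp (-K ^ 10) * T ≤ r → ¬ FiresOnBudget K ε R T C θ r) ∧
            (∀ r, 2 * ε ≤ r → ¬ FiresOnBudget K ε R T C θ r) := by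
  obtain ⟨C, hC, K₀, hK₀, hK⟩ := delaySolution_hasAbruptTransition
  refine ⟨C, hC, K₀, hK₀, fun K hKK hCK => ?_⟩
  obtain ⟨ε₁, hε₁, hε⟩ := hK K hKK
  refine ⟨ε₁, hε₁, fun ε hε0 hεε hε2 R hR T θ hT htol => ?_⟩
  have hX := hε ε hε0 hεε
  have hθ : C / K ^ 10 + θ < 1 := by linarith [exp_pos (-K ^ 10)]
  exact ⟨firesOnBudget_shadowRadius hR hX,
    fun r hr => not_firesOnBudget_of_seed_mul_le hR hC.le (hCK.trans hT) hθ hr,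
    fun r hr => not_firesOnBudget_of_two_mul_eps_le hR hε0 hε2 hCK hT htol hr⟩

end Literature.Analysis.FluidPDE.Tao2016AveragedNS
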